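import Summits.BirchSwinnertonDyer.BirchSwinnertonDyer.Theorems.AdditiveKolyvaginRoadLevelSystemsRigidityCore
import HarnessLib

/-!
# Route `AdditiveKolyvaginRoad`, crux `LevelKolyvaginSystemsAdditive` (item stmt-BirchSwinnertonDyer-21396, KS′):
# the global-duality DICHOTOMY for the total rank of the two-sign level spaces — parity, cores above every level
# (Howard Lemma 2.4.9), descent of locally trivial classes — abstract
# (cell `pub/bsd-wall`, width seat `bsd-wall-akr-p2x-w2` g2; `--supports stmt-BirchSwinnertonDyer-21396`, helper; part 4a, feeding
# part 4b `…LevelSystemsRigidityConnected` (Howard Lemma 2.4.10 ∕ Prop. 2.4.11: the core graph is connected))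

WHY. Parts 1–3 (`…LevelSystemsRigidityCore`, `…LevelSystemsRigidity`, `…LevelSystemsOfIgnition`) reduced the carrier's
forcing field `baseCase` (W. Zhang Thm 7.2 at EVERY even level of canonical rank one) to ONE seed + CONNECTIVITY of Howard's
core graph (vertices = levels, edges `a — a ∪ {q}` whose odd end has both canonical spaces zero). Connectivity (Howard 2006,
Lemma 2.4.9 ∕ 2.4.10 ∕ Prop. 2.4.11) is a COMBINATORIAL consequence of rank statements about the canonical spaces at ONE
more admissible prime and of Čebotarev. Parts 4a/4b prove that implication in ENGINE currency (level spaces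
`Sel : Finset Q → Bool → Submodule F H` over a field, a «locally trivial above `q`» predicate `T`, a SIGN `ε : Q → Bool` of the
admissible primes), from the HYPOTHESES
* (Inert) `Sel_{m∪q}^{¬ε q} = Sel_m^{¬ε q}`, and every `(¬ε q)`-eigenclass is locally trivial above `q` (W. Zhang (9.2); tree
  `loc_eq_zero_of_sign_ne_odd`, `selQP_insert_eq_of_forall_mem_torsionLocalKer`);
* (Lower) some class of `Sel_m^{ε q}` detected above the NEW `q` ⟹ `Sel_{m∪q}^{ε q} ≤ Sel_m^{ε q}` of codimension one, all of
  it locally trivial above `q` (W. Zhang Lemma 5.3 ∕ Prop. 5.4 lowering half — Poitou–Tate-FREE; tree: (A1)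
  `stub_rankLoweringAdditive` in existential form);
* (Raise) every class of `Sel_m^{ε q}` locally trivial above `q` ⟹ `Sel_m^{ε q} ≤ Sel_{m∪q}^{ε q}` of codimension one (raising
  half; tree: (R) `selQP_raise_of_admQ` modulo `poitouTate_selmerStructure_duality`);
* (Cheb) a non-zero `μ`-eigenclass is detected above admissible primes of sign `μ` outside any finite set (W. Zhang Lemma 7.3,
  BD05 Thm. 3.2; tree `exists_admQ_notMem_torsionLocalKer` + (Equiv));
* ODD total rank at the bottom level (`dim_{𝔽_p} Sel_p(E/K)` odd at an `r_an = 1` frame).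
THIS FILE (4a): Howard's «Corollary (rho)» for the TOTAL rank `r(m) = dim Sel_m⁺ + dim Sel_m⁻` — `r(m∪q) = r(m) − 1` if a
class is detected, `+ 1` if not (`total_insert_of_detected` ∕ `_of_undetected`) —, the PARITY `r(m) odd ⟺ #m even`
(`odd_total_iff_even_card`), the shape of levels of total rank `0` ∕ `1` (`eq_bot_and_eq_bot_of_total_eq_zero`,
`exists_generator_of_total_eq_one`), the DESCENT of a class locally trivial above a set of primes (`mem_of_forall_triv`,
iterated Howard Lemma 2.3.3), and CORES ABOVE (`exists_core_superset`, Howard Lemma 2.4.9: above every level there is one of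
total rank `≤ 1`).

HONEST FRAMING: pure linear algebra + combinatorics (Mathlib `Submodule`, `finrank`, `Finset`); 0 definitions, 0 named facts,
0 `sorry`; (Inert) ∕ (Lower) ∕ (Raise) ∕ (Cheb) are HYPOTHESES; closes nothing. BSD is not proved by any of this.

References: [cite: Howard2006Bipartite, Lemma 2.3.3, Cor. 2.3.5, Lemma 2.4.9] [cite: WZhang2014, Lemma 5.3, Prop. 5.4,
Lemma 7.3, §9 (9.1)–(9.3)] [cite: BertoliniDarmon2005, Lemma 2.6, Thm. 3.2].
-/

noncomputable section

open scoped Classical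

namespace Summit.BirchSwinnertonDyer.Rank1Residual.X11b.Three.Koly.CoreGraph

open Module

variable {F : Type*} [Field F] {H : Type*} [AddCommGroup H] [Module F H] {Q : Type*} [DecidableEq Q]
  (Sel : Finset Q → Bool → Submodule F H) (T : Q → H → Prop) (ε : Q → Bool)

/-! ## §1 The total rank: dichotomy at one more prime, parity, generators -/

omit [DecidableEq Q] in
/-- The total rank does not depend on which eigenspace is listed first. [folklore] -/
theorem finrank_add_finrank_not (m : Finset Q) (μ : Bool) :
    finrank F (Sel m μ) + finrank F (Sel m (!μ)) = finrank F (Sel m true) + finrank F (Sel m false) := by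
  cases μ
  · rw [Bool.not_false, add_comm]
  · rw [Bool.not_true]

/-- **Dichotomy, LOWERING branch for the total rank** (Howard's Cor. (rho), W. Zhang Prop. 5.4): if some `ε(q)`-eigenclass of
level `m` is detected above the new `q`, the total rank DROPS by exactly one at `m ∪ {q}` ((Lower) in the sign `ε q`, (Inert) in
the other). [cite: Howard2006Bipartite, Cor. 2.3.5] [cite: WZhang2014, Prop. 5.4] -/
theorem total_insert_of_detected
    (hInert : ∀ (m : Finset Q) (q : Q), q ∉ m → Sel (insert q m) (!ε q) = Sel m (!ε q))
    (hLower : ∀ (m : Finset Q) (q : Q), q ∉ m → (∃ x ∈ Sel m (ε q), ¬ T q x) →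
      Sel (insert q m) (ε q) ≤ Sel m (ε q) ∧ finrank F (Sel (insert q m) (ε q)) + 1 = finrank F (Sel m (ε q)) ∧
      ∀ y ∈ Sel (insert q m) (ε q), T q y)
    {m : Finset Q} {q : Q} (hqm : q ∉ m) (hx : ∃ x ∈ Sel m (ε q), ¬ T q x) :
    finrank F (Sel (insert q m) true) + finrank F (Sel (insert q m) false) + 1 =
      finrank F (Sel m true) + finrank F (Sel m false) := by
  obtain ⟨-, hrank, -⟩ := hLower m q hqm hx
  rw [← finrank_add_finrank_not Sel (insert q m) (ε q), ← finrank_add_finrank_not Sel m (ε q), hInert m q hqm]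
  omega

/-- **Dichotomy, RAISING branch for the total rank**: if every `ε(q)`-eigenclass of level `m` is locally trivial above the new
`q`, the total rank RISES by exactly one at `m ∪ {q}` ((Raise) in the sign `ε q`, (Inert) in the other).
[cite: Howard2006Bipartite, Cor. 2.3.5] [cite: WZhang2014, Lemma 5.3] -/
theorem total_insert_of_undetected
    (hInert : ∀ (m : Finset Q) (q : Q), q ∉ m → Sel (insert q m) (!ε q) = Sel m (!ε q))
    (hRaise : ∀ (m : Finset Q) (q : Q), q ∉ m → (∀ x ∈ Sel m (ε q), T q x) →
      Sel m (ε q) ≤ Sel (insert q m) (ε q) ∧ finrank F (Sel (insert q m) (ε q)) = finrank F (Sel m (ε q)) + 1)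
    {m : Finset Q} {q : Q} (hqm : q ∉ m) (hx : ∀ x ∈ Sel m (ε q), T q x) :
    finrank F (Sel (insert q m) true) + finrank F (Sel (insert q m) false) =
      finrank F (Sel m true) + finrank F (Sel m false) + 1 := by
  obtain ⟨-, hrank⟩ := hRaise m q hqm hx
  rw [← finrank_add_finrank_not Sel (insert q m) (ε q), ← finrank_add_finrank_not Sel m (ε q), hInert m q hqm]
  omega

/-- **Parity of the total rank** (Gross–Parson ∕ W. Zhang Lemma 5.1 shape, here DERIVED from the dichotomy): if the bottom
level has odd total rank, a level `m` has odd total rank iff `#m` is even. [cite: WZhang2014, §5] [cite: Howard2006Bipartite, Cor. 2.3.5] -/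
theorem odd_total_iff_even_card
    (hInert : ∀ (m : Finset Q) (q : Q), q ∉ m → Sel (insert q m) (!ε q) = Sel m (!ε q))
    (hLower : ∀ (m : Finset Q) (q : Q), q ∉ m → (∃ x ∈ Sel m (ε q), ¬ T q x) →
      Sel (insert q m) (ε q) ≤ Sel m (ε q) ∧ finrank F (Sel (insert q m) (ε q)) + 1 = finrank F (Sel m (ε q)) ∧
      ∀ y ∈ Sel (insert q m) (ε q), T q y)
    (hRaise : ∀ (m : Finset Q) (q : Q), q ∉ m → (∀ x ∈ Sel m (ε q), T q x) →
      Sel m (ε q) ≤ Sel (insert q m) (ε q) ∧ finrank F (Sel (insert q m) (ε q)) = finrank F (Sel m (ε q)) + 1)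
    (hodd : Odd (finrank F (Sel ∅ true) + finrank F (Sel ∅ false))) (m : Finset Q) :
    Odd (finrank F (Sel m true) + finrank F (Sel m false)) ↔ Even m.card := by
  induction m using Finset.induction_on with
  | empty => simp only [Finset.card_empty, Even.zero, iff_true]; exact hodd
  | insert q m hqm ih =>
    rw [Finset.card_insert_of_notMem hqm, Nat.even_add_one]
    by_cases hx : ∃ x ∈ Sel m (ε q), ¬ T q x
    · have h := total_insert_of_detected Sel T ε hInert hLower hqm hx
      rw [← h, Nat.odd_add_one] at ih
      rw [← ih, not_not]
    · push Not at hx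
      rw [total_insert_of_undetected Sel T ε hInert hRaise hqm hx, Nat.odd_add_one, ih]

omit [DecidableEq Q] in
/-- A level of total rank zero has both canonical spaces zero (finite-dimensionality). [folklore] -/
theorem eq_bot_and_eq_bot_of_total_eq_zero (hfin : ∀ (m : Finset Q) (μ : Bool), Module.Finite F (Sel m μ))
    {m : Finset Q} (h0 : finrank F (Sel m true) + finrank F (Sel m false) = 0) :
    Sel m true = ⊥ ∧ Sel m false = ⊥ := by
  haveI := hfin m true
  haveI := hfin m false
  exact ⟨Submodule.finrank_eq_zero.mp (by omega), Submodule.finrank_eq_zero.mp (by omega)⟩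

omit [DecidableEq Q] in
/-- A level of total rank one: one sign carries a line with a generator, the other sign is zero. [folklore] -/
theorem exists_generator_of_total_eq_one (hfin : ∀ (m : Finset Q) (μ : Bool), Module.Finite F (Sel m μ))
    {m : Finset Q} (h1 : finrank F (Sel m true) + finrank F (Sel m false) = 1) :
    ∃ (μ : Bool) (s : H), finrank F (Sel m μ) = 1 ∧ Sel m (!μ) = ⊥ ∧ s ∈ Sel m μ ∧ s ≠ 0 ∧
      ∀ y ∈ Sel m μ, ∃ c : F, c • s = y := by
  obtain ⟨μ, hμ1, hμ0⟩ : ∃ μ : Bool, finrank F (Sel m μ) = 1 ∧ finrank F (Sel m (!μ)) = 0 := by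
    rcases Nat.eq_zero_or_pos (finrank F (Sel m true)) with h | h
    · exact ⟨false, by omega, h⟩
    · exact ⟨true, by omega, by change finrank F (Sel m false) = 0; omega⟩
  haveI := hfin m (!μ)
  obtain ⟨⟨s, hs⟩, hs0, hgen⟩ := finrank_eq_one_iff'.mp hμ1
  refine ⟨μ, s, hμ1, Submodule.finrank_eq_zero.mp hμ0, hs, fun h ↦ hs0 (Subtype.ext h), fun y hy ↦ ?_⟩
  obtain ⟨c, hc⟩ := hgen ⟨y, hy⟩
  exact ⟨c, congrArg Subtype.val hc⟩

/-- **Descent of a class locally trivial above a set of primes** (iterated «out» bookkeeping, Howard Lemma 2.3.3): a class of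
level `a ∪ t` locally trivial above every prime of `t` outside `a` is a class of level `a`. [cite: Howard2006Bipartite, Lemma 2.3.3] -/
theorem mem_of_forall_triv
    (hOut : ∀ (n : Finset Q) (q : Q) (μ : Bool) (z : H), q ∉ n → z ∈ Sel (insert q n) μ → T q z → z ∈ Sel n μ)
    (t : Finset Q) {a : Finset Q} {μ : Bool} {y : H} (htriv : ∀ q ∈ t, q ∉ a → T q y) (hy : y ∈ Sel (a ∪ t) μ) :
    y ∈ Sel a μ := by
  induction t using Finset.induction_on generalizing a with
  | empty => simpa only [Finset.union_empty] using hy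
  | insert q t hqt ih =>
    rw [Finset.union_insert] at hy
    by_cases hqa : q ∈ a
    · rw [Finset.insert_eq_of_mem (Finset.mem_union_left t hqa)] at hy
      exact ih (fun q' hq' ↦ htriv q' (Finset.mem_insert_of_mem hq')) hy
    · have hq : q ∉ a ∪ t := by
        rw [Finset.mem_union, not_or]
        exact ⟨hqa, hqt⟩
      exact ih (fun q' hq' ↦ htriv q' (Finset.mem_insert_of_mem hq'))
        (hOut _ q μ y hq hy (htriv q (Finset.mem_insert_self q t) hqa))

/-! ## §2 Above every level there is a core level (Howard Lemma 2.4.9) -/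

/-- A submodule of positive dimension has a non-zero element. [folklore] -/
theorem exists_mem_ne_zero_of_finrank_pos' {S : Submodule F H} (h : 0 < finrank F S) : ∃ x ∈ S, x ≠ 0 := by
  by_contra hc
  push Not at hc
  rw [(Submodule.eq_bot_iff S).mpr hc, finrank_bot] at h
  exact lt_irrefl 0 h

/-- **Cores above** (Howard 2006, Lemma 2.4.9, second part): above every level `m` there is a level `n ⊇ m` of total rank
`≤ 1` — add, while the total rank is `≥ 2`, a Čebotarev prime of the sign of a non-zero class detecting it (each time the
total rank drops by one, by (Lower) + (Inert)). [cite: Howard2006Bipartite, Lemma 2.4.9] [cite: WZhang2014, Prop. 5.4, Lemma 7.3] -/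
theorem exists_core_superset
    (hInert : ∀ (m : Finset Q) (q : Q), q ∉ m → Sel (insert q m) (!ε q) = Sel m (!ε q))
    (hLower : ∀ (m : Finset Q) (q : Q), q ∉ m → (∃ x ∈ Sel m (ε q), ¬ T q x) →
      Sel (insert q m) (ε q) ≤ Sel m (ε q) ∧ finrank F (Sel (insert q m) (ε q)) + 1 = finrank F (Sel m (ε q)) ∧
      ∀ y ∈ Sel (insert q m) (ε q), T q y)
    (hCheb : ∀ (B m : Finset Q) (μ : Bool) (x : H), x ∈ Sel m μ → x ≠ 0 → ∃ q, q ∉ B ∧ ε q = μ ∧ ¬ T q x)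
    (m : Finset Q) : ∃ n : Finset Q, m ⊆ n ∧ finrank F (Sel n true) + finrank F (Sel n false) ≤ 1 := by
  suffices H : ∀ (k : ℕ) (m : Finset Q), finrank F (Sel m true) + finrank F (Sel m false) = k →
      ∃ n : Finset Q, m ⊆ n ∧ finrank F (Sel n true) + finrank F (Sel n false) ≤ 1 from H _ m rfl
  intro k
  induction k using Nat.strong_induction_on with
  | _ k ih =>
    intro m hk
    by_cases h1 : k ≤ 1
    · exact ⟨m, Finset.Subset.refl m, hk ▸ h1⟩
    · -- some eigenspace has a non-zero class
      obtain ⟨μ, hμ⟩ : ∃ μ : Bool, 0 < finrank F (Sel m μ) := by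
        by_contra hc
        push Not at hc
        have ht := hc true
        have hf := hc false
        omega
      obtain ⟨x, hx, hx0⟩ := exists_mem_ne_zero_of_finrank_pos' hμ
      obtain ⟨q, hqm, hεq, hD⟩ := hCheb m m μ x hx hx0
      have hx' : ∃ x ∈ Sel m (ε q), ¬ T q x := ⟨x, by rw [hεq]; exact hx, hD⟩
      have hstep := total_insert_of_detected Sel T ε hInert hLower hqm hx'
      obtain ⟨n, hmn, hn⟩ := ih (k - 1) (by omega) (insert q m) (by omega)
      exact ⟨n, (Finset.subset_insert q m).trans hmn, hn⟩


end Summit.BirchSwinnertonDyer.Rank1Residual.X11b.Three.Koly.CoreGraph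

end
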